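import Literature.Probability.LatticeModels.PlaneRotatorOnsagerWindowStiffness
import Literature.Probability.LatticeModels.SharpnessDecayProofs
import Literature.Probability.LatticeModels.PlanarIsingCriticalBeta
import Literature.Probability.LatticeModels.ThermodynamicLimit
import HarnessLib

/-!
# Aizenman–Simon's `β_c^{rotor} ≥ 2β_c^{Ising}` in every dimension: the plane rotator on `ℤ^d` clusters, and
# Lieb's finite algorithm terminates, for every `K < 2β_c(d)`

Topic `Literature/Probability/LatticeModels`, namespace `Literature.Probability.LatticeModels` (rotator-side
declarations under `PlaneRotator`). M. Aizenman, B. Simon, *A comparison of plane rotor and Ising models*,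
Phys. Lett. **76A** (1980) 281–282 [AizenmanSimon1980RotorIsing], eq. (2): «`β_c^R ≥ 2β_c^I`» for the critical
inverse temperatures defined by the loss of exponential clustering, in ANY dimension (the paper's eq. (1)
`⟨s⃗_α·s⃗_γ⟩_{2β,rotor} ≤ ⟨σ_ασ_γ⟩_{β,Ising}` holds bond by bond on every finite graph; it is the tree's kernel theorem
`PlaneRotator.AizenmanSimonRotorIsingComparison_holds`). The sibling file `PlaneRotatorOnsagerWindow.lean` proved the
square-lattice case `K < log(1+√2) = 2·½log(1+√2)` with the a-priori Ising decay taken from the EXACT SOLUTION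
(Wu 1966, `criticalBetaTwo = ½log(1+√2)`). Here the Ising input is the tree's general SHARPNESS theorem
`twoPoint_exponentialDecay_of_lt_criticalBeta_holds` (Aizenman–Barsky–Fernández 1987 / Duminil-Copin–Tassion 2016,
PROVED in the tree: for `d ≥ 2` and `0 ≤ β < β_c(d)`, `⟨σ₀σ_x⟩^∅_β ≤ e^{−c‖x‖_∞}`), where
`β_c(d) = criticalBeta d = inf{β ≥ 0 : m*(β) > 0}` is the TRUE critical point of the nearest-neighbour Ising model on
`ℤ^d` (`IsingThermodynamics.lean`). Everything below is hypothesis-free and numerics-free.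

* §1 `PlaneRotator.nnBoxShellSum_le_card_mul_exp` (any `d`) — `S_R(K) ≤ (2R+1)^d·C·e^{−cR}` whenever `0 ≤ K ≤ K'`
  and `⟨σ₀σ_x⟩^∅_{K'/2} ≤ C e^{−c‖x‖_∞}` on `ℤ^d` (the `d`-dimensional form of `nnBoxShellSum_two_le_card_mul_exp`).
* §2 **`PlaneRotator.exists_nnBoxShellSum_lt_one_of_lt_two_mul_criticalBeta`** — `d ≥ 2`, `0 ≤ K < 2β_c(d)` ⇒
  `∃ R ≥ 1, S_R(K) = nnBoxShellSum K d R < 1`: the converse half of Lieb's box criterion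
  (`PlaneRotatorLiebBoxCriterion.lean`, «Not here: the converse») on `ℤ^d`, throughout Aizenman–Simon's window.
* §3 **`PlaneRotator.twoPoint_nn_exp_decay_of_lt_two_mul_criticalBeta`** — A–S eq. (2) itself: for `d ≥ 2` and
  `0 ≤ K < 2β_c(d)` there is `c > 0` with `⟨cos(θ_a − θ_b)⟩_{Λ,K} ≤ e^{−c‖b−a‖_∞}` for EVERY finite `Λ ⊂ ℤ^d` and all
  `a, b ∈ Λ` (free boundary conditions; constant `C = 1`).
* §4 `d = 2` with the true Ising critical point: `log(1+√2) ≤ 2β_c(2)` (tree `criticalBetaTwo_le_criticalBeta_two`;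
  equality = Kramers–Wannier–Onsager, of which the tree holds the `≤` half), so §2–§3 at `d = 2` CONTAIN the Onsager
  window of record; **`tendsto_torusXYStiffness_of_lt_two_mul_criticalBeta_two`** (`βΥ_{L+1}(K) → 0` for every
  `0 ≤ K < 2β_c(2)`) and **`kt_le_div_two_mul_criticalBeta_two_of_pos_below`**: every stiffness profile of the
  classical XY comparison model that is positive below `T_c` has `T_c ≤ J/(2β_c(2)) = ½·T_c^{Ising}(ℤ²)` — the literal
  Aizenman–Simon sentence «`k T_c^R ≤ ½ k T_c^I`», with NO universal-jump input (the Onsager-window bound of record `T_c ≤ J/log(1+√2)` follows by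
  `div_two_mul_criticalBeta_two_le_div_log`).
* §5 `d = 3`, the ISOTROPIC endpoint of the cell's interlayer grammar: `layeredXYCoupling β J J = nnXYCoupling (βJ) 3`
  (`PlaneRotator.layeredXYCoupling_self`), hence **`twoPoint_layered_self_exp_decay_of_lt_two_mul_criticalBeta_three`**:
  the layered classical XY model at `J⊥ = J∥ = J` clusters exponentially on every finite `Λ ⊂ ℤ³` whenever
  `βJ < 2β_c(3)`, i.e. `T_c^{3D-XY}(J, J) ≤ ½·T_c^{Ising}(ℤ³)` in the only sense available (no `T_c` is defined for
  rotators in the tree; `β_c(3)` carries no kernel number — [float] `β_c(3) ≈ 0.22165`, `½T_c^{Is}(ℤ³) ≈ 2.256·J`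
  against the rotator's `T_c ≈ 2.202·J`, for orientation only).

Cell use (`pub/hubbard-tc`, MO-S3; T1 lemma group, classical side; ASSUMPTIONS key K5 «`T_c ≤ ½T_c^{Ising}`»): the
XY-comparison key's Ising sentence is now a theorem of the tree in every dimension, not only through Fisher's
mean-field bound or Onsager's number.

## What this is not

Statements about the classical plane rotator and the classical Ising model only; no electronic model, no kelvin, no
number of record; the Kosterlitz–Thouless / universal-jump relation (K2) is neither used nor proved; the window
`K < 2β_c(d)` is Aizenman–Simon's, not the rotator's critical point (`d = 2`: `0.8814 ≤ 2β_c(2)` vs `K_c ≈ 1.12`;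
`d = 3`: `2β_c(3) ≈ 0.443` vs `K_c ≈ 0.454` [float]).
-/

noncomputable section

open MeasureTheory Finset Filter Topology
open scoped BigOperators

namespace Literature.Probability.LatticeModels

open Literature.Barriers.CriticalPhenomena Literature.Barriers.CriticalPhenomena.LongRangeIsing

namespace PlaneRotator

/-! ## §1 Lieb's number on `ℤ^d` below an exponentially decaying Ising two-point function -/

/-- Membership in the reference shell: `‖b‖_∞ = R`. [cite: Lieb1980, p. 128 (B the boundary of a box)] -/
private theorem mem_refShell_iff' {d R : ℕ} {b : box d R} : b ∈ refShell d R ↔ Site.supNorm (b : Site d) = R := by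
  simp [refShell]

/-- Nearest neighbours of `ℤ^d`: `nnCoupling d x y = 𝟙{x ∼ y}` for the graph `zdGraph d`. [folklore] -/
private theorem nnCoupling_eq_ite_adj' {d : ℕ} (x y : Site d) :
    nnCoupling d x y = if (zdGraph d).Adj x y then 1 else 0 := by
  have hadj : (zdGraph d).Adj x y ↔ l1Norm (x - y) = 1 := by
    rw [zdGraph_adj_iff_norm_holds x y]
    have h : ((l1Norm (x - y) : ℕ) : ℤ) = ∑ i, |x i - y i| := by
      simp only [l1Norm, Nat.cast_sum, Int.natCast_natAbs, Pi.sub_apply]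
    rw [← h]
    norm_cast
  unfold nnCoupling
  simp only [hadj]

variable {d : ℕ} [MeasurableSpace Circle] [BorelSpace Circle]

/-- **Lieb's number on `ℤ^d` inside an Ising clustering window**: if `0 ≤ K ≤ K'` and the free Ising two-point
function of `ℤ^d` at `β = K'/2` obeys `⟨σ₀σ_x⟩^∅ ≤ C e^{−c‖x‖_∞}`, then
`S_R(K) = nnBoxShellSum K d R ≤ (2R+1)^d · C · e^{−cR}` (Aizenman–Simon on the box with the shell–shell bonds removed,
Griffiths in couplings and volume, and the shell has at most `(2R+1)^d` sites).
[cite: AizenmanSimon1980RotorIsing, eq. (1); Lieb1980, Theorem 4 and p. 128 (boxes)] -/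
theorem nnBoxShellSum_le_card_mul_exp {K K' C c : ℝ} (hK : 0 ≤ K) (hKK' : K ≤ K') (hC : 0 ≤ C)
    (hdec : ∀ x : Site d, twoPointFree d (K' / 2) x ≤ C * Real.exp (-c * ‖x‖)) (R : ℕ) :
    nnBoxShellSum K d R ≤ (2 * R + 1) ^ d * C * Real.exp (-c * R) := by
  classical
  have hJf0 : ∀ x y : Site d, 0 ≤ K / 2 * nnCoupling d x y :=
    fun x y => mul_nonneg (by positivity) (nnCoupling_nonneg _ _)
  have h1 := boxShellSum_le_isingBoxShellSum hJf0 R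
  have hhalf : (fun x y : Site d => K / 2 * nnCoupling d x y / 2) = fun x y => K / 4 * nnCoupling d x y := by
    funext x y; ring
  rw [hhalf] at h1
  have h2 := isingBoxShellSum_nn_le_sum_twoPointFree (d := d) hK hKK' R
  have h3 : ∑ b ∈ refShell d R, twoPointFree d (K' / 2) (b : Site d) ≤
      ∑ _b ∈ refShell d R, C * Real.exp (-c * R) := by
    refine Finset.sum_le_sum fun b hb => ?_
    have hnorm : ‖(b : Site d)‖ = (R : ℝ) := by
      rw [Site.norm_eq_supNorm, mem_refShell_iff'.1 hb]
    have := hdec (b : Site d)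
    rwa [hnorm] at this
  have h4 : (∑ _b ∈ refShell d R, C * Real.exp (-c * R)) ≤ (2 * R + 1) ^ d * C * Real.exp (-c * R) := by
    rw [Finset.sum_const, nsmul_eq_mul, ← mul_assoc]
    refine mul_le_mul_of_nonneg_right (mul_le_mul_of_nonneg_right ?_ hC) (Real.exp_nonneg _)
    have hcard : (refShell d R).card ≤ (2 * R + 1) ^ d := by
      calc (refShell d R).card ≤ Fintype.card (box d R) := Finset.card_le_univ _
        _ = (2 * R + 1) ^ d := by rw [Fintype.card_coe, card_box]
    exact_mod_cast hcard
  unfold nnBoxShellSum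
  exact h1.trans (h2.trans (h3.trans h4))

/-! ## §2 The converse of Lieb's box criterion on `ℤ^d` for every `K < 2β_c(d)` -/

omit [MeasurableSpace Circle] [BorelSpace Circle] in
/-- An interior point of the window: for `0 ≤ K < 2β_c(d)` the coupling `K' = (K + 2β_c(d))/2` has `K ≤ K'` and
`0 ≤ K'/2 < β_c(d)`. [folklore] -/
private theorem interior_coupling {K : ℝ} (hK0 : 0 ≤ K) (hK : K < 2 * criticalBeta d) :
    K ≤ (K + 2 * criticalBeta d) / 2 ∧ 0 ≤ (K + 2 * criticalBeta d) / 2 / 2 ∧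
      (K + 2 * criticalBeta d) / 2 / 2 < criticalBeta d := by
  refine ⟨by linarith, by linarith, by linarith⟩

omit [MeasurableSpace Circle] [BorelSpace Circle] in
/-- The majorant `(2R+1)^d e^{−cR}` tends to `0` (`c > 0`). [folklore] -/
private theorem tendsto_card_mul_exp {c : ℝ} (hc : 0 < c) :
    Tendsto (fun R : ℕ => (2 * (R : ℝ) + 1) ^ d * Real.exp (-c * R)) atTop (𝓝 0) := by
  -- `r = e^{-c} ∈ (0,1)`; `(2R+1)^d r^R ≤ 3^d · R^d r^R` for `R ≥ 1`, and `R^d r^R → 0`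
  set r : ℝ := Real.exp (-c) with hr
  have hr0 : 0 < r := Real.exp_pos _
  have hr1 : r < 1 := Real.exp_lt_one_iff.2 (by linarith)
  have hrabs : |r| < 1 := by rw [abs_of_pos hr0]; exact hr1
  have hexp : ∀ R : ℕ, Real.exp (-c * R) = r ^ R := fun R => by
    rw [hr, ← Real.exp_nat_mul]; ring_nf
  have hlim : Tendsto (fun R : ℕ => (3 : ℝ) ^ d * ((R : ℝ) ^ d * r ^ R)) atTop (𝓝 0) := by
    have h := (tendsto_pow_const_mul_const_pow_of_abs_lt_one d hrabs).const_mul ((3 : ℝ) ^ d)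
    rwa [mul_zero] at h
  refine squeeze_zero_norm' ?_ hlim
  filter_upwards [eventually_ge_atTop 1] with R hR
  rw [Real.norm_eq_abs, abs_of_nonneg (by positivity), hexp R, ← mul_assoc, ← mul_pow]
  refine mul_le_mul_of_nonneg_right (pow_le_pow_left₀ (by positivity) ?_ d) (pow_nonneg hr0.le R)
  have : (1 : ℝ) ≤ R := by exact_mod_cast hR
  linarith

/-- **Lieb's finite algorithm terminates throughout Aizenman–Simon's window, in every dimension.** For `d ≥ 2` and
every `0 ≤ K < 2β_c(d)` — `β_c(d)` the critical inverse temperature of the nearest-neighbour Ising model on `ℤ^d` —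
there is a box radius `R ≥ 1` with `S_R(K) = nnBoxShellSum K d R < 1`: the converse half of Lieb's box criterion for
the nearest-neighbour plane rotator on `ℤ^d`, the a-priori decay being supplied by the Ising model at half the coupling
(Aizenman–Simon eq. (1)) where it is the sharpness theorem (Aizenman–Barsky–Fernández; Duminil-Copin–Tassion; tree
`twoPoint_exponentialDecay_of_lt_criticalBeta_holds`). No hypothesis, no numerics.
[cite: AizenmanSimon1980RotorIsing, eqs. (1)–(2); Lieb1980, Theorem 4 and p. 128 (boxes)] -/
theorem exists_nnBoxShellSum_lt_one_of_lt_two_mul_criticalBeta (hd : 2 ≤ d) {K : ℝ} (hK0 : 0 ≤ K)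
    (hK : K < 2 * criticalBeta d) :
    ∃ R : ℕ, 1 ≤ R ∧ nnBoxShellSum K d R < 1 := by
  obtain ⟨hKK', hβ0, hβc⟩ := interior_coupling (d := d) hK0 hK
  obtain ⟨c, hc, hdec⟩ := twoPoint_exponentialDecay_of_lt_criticalBeta_holds (d := d) hd hβ0 hβc
  have hdec' : ∀ x : Site d, twoPointFree d ((K + 2 * criticalBeta d) / 2 / 2) x ≤ 1 * Real.exp (-c * ‖x‖) :=
    fun x => by rw [one_mul]; exact hdec x
  have hev : ∀ᶠ R : ℕ in atTop, (2 * (R : ℝ) + 1) ^ d * Real.exp (-c * R) < 1 :=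
    (tendsto_card_mul_exp (d := d) hc).eventually (gt_mem_nhds one_pos)
  obtain ⟨R, hR1, hRlt⟩ := ((eventually_ge_atTop 1).and hev).exists
  refine ⟨R, hR1, (nnBoxShellSum_le_card_mul_exp hK0 hKK' zero_le_one hdec' R).trans_lt ?_⟩
  simpa using hRlt

/-! ## §3 Aizenman–Simon eq. (2): uniform exponential clustering of the rotator for `K < 2β_c(d)` -/

/-- **Aizenman–Simon 1980, eq. (2) «`β_c^R ≥ 2β_c^I`», as a theorem on every finite volume and in every dimension**:
for `d ≥ 2` and `0 ≤ K < 2β_c(d)` there is `c > 0` such that for EVERY finite `Λ ⊂ ℤ^d` (free boundary conditions)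
and all `a, b ∈ Λ`, `⟨cos(θ_a − θ_b)⟩_{Λ,K} ≤ e^{−c‖b − a‖_∞}` — eq. (1) on `Λ` (kernel theorem
`AizenmanSimonRotorIsingComparison_holds`), Griffiths in couplings and volume (`PairIsing.avg_spinPair_le_twoPointFree`),
and sharpness of the Ising transition at `β = K'/2 < β_c(d)`, `K' = (K + 2β_c(d))/2`.
[cite: AizenmanSimon1980RotorIsing, eqs. (1)–(2)] -/
theorem twoPoint_nn_exp_decay_of_lt_two_mul_criticalBeta (hd : 2 ≤ d) {K : ℝ} (hK0 : 0 ≤ K)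
    (hK : K < 2 * criticalBeta d) :
    ∃ c : ℝ, 0 < c ∧ ∀ (Λ : Finset (Site d)) (a b : Λ),
      twoPoint (nnXYCoupling K d Λ) a b ≤ Real.exp (-c * ‖(b : Site d) - a‖) := by
  classical
  obtain ⟨hKK', hβ0, hβc⟩ := interior_coupling (d := d) hK0 hK
  set K' : ℝ := (K + 2 * criticalBeta d) / 2 with hK'
  obtain ⟨c, hc, hdec⟩ := twoPoint_exponentialDecay_of_lt_criticalBeta_holds (d := d) hd hβ0 hβc
  refine ⟨c, hc, fun Λ a b => ?_⟩
  -- Aizenman–Simon on `Λ` with `c(x,y) = K/4 · 𝟙{x ∼ y}` (`2c` = the XY couplings `K/2` per ordered pair)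
  set cpl : Λ → Λ → ℝ := fun x y => K / 4 * nnCoupling d (x : Site d) y with hcpl
  have hcpl0 : ∀ x y, 0 ≤ cpl x y := fun x y => mul_nonneg (by positivity) (nnCoupling_nonneg _ _)
  have hAS := AizenmanSimonRotorIsingComparison_holds Λ cpl hcpl0 a b
  have h2c : (fun p : Λ × Λ => 2 * cpl p.1 p.2) = nnXYCoupling K d Λ := by
    funext p; simp only [hcpl, nnXYCoupling]; ring
  rw [h2c] at hAS
  refine hAS.trans ((PairIsing.avg_spinPair_le_twoPointFree (β := K' / 2) hβ0 Λ
    (fun x y => ?_) a b).trans (hdec _))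
  -- `|K/4 · 𝟙{x ∼ y}| ≤ (K'/2)/2 · 𝟙{x ∼ y}`
  simp only [hcpl, nnCoupling_eq_ite_adj']
  split_ifs
  · rw [mul_one, abs_of_nonneg (by positivity)]; linarith
  · rw [mul_zero, abs_zero]

end PlaneRotator

open PlaneRotator Literature.MathematicalPhysics.QuantumLattice
open Literature.MathematicalPhysics.StatisticalMechanics.KosterlitzThouless

variable [MeasurableSpace Circle] [BorelSpace Circle]

/-! ## §4 `d = 2` with the true Ising critical point: the window contains Onsager's, the stiffness vanishes in it, and
`T_c^{XY} ≤ ½·T_c^{Ising}(ℤ²)` for every profile positive below `T_c` -/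

omit [MeasurableSpace Circle] [BorelSpace Circle] in
/-- **`log(1+√2) ≤ 2β_c(2)`**: the Aizenman–Simon window of the square lattice stated with the TRUE Ising critical
point contains the Onsager window `K < log(1+√2)` of `PlaneRotatorOnsagerWindow.lean` (tree:
`criticalBetaTwo_le_criticalBeta_two`, `criticalBetaTwo = ½log(1+√2)`; the reverse inequality is the
Kramers–Wannier–Onsager identification `β_c(2) = ½log(1+√2)`, not used).
[cite: AizenmanSimon1980RotorIsing, eq. (2) (β_c^I = ½ln(1+√2) in d = 2)] -/
theorem log_one_add_sqrt_two_le_two_mul_criticalBeta_two :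
    Real.log (1 + Real.sqrt 2) ≤ 2 * criticalBeta 2 := by
  rw [log_one_add_sqrt_two_eq_two_mul_criticalBetaTwo]
  exact mul_le_mul_of_nonneg_left criticalBetaTwo_le_criticalBeta_two zero_le_two

omit [MeasurableSpace Circle] [BorelSpace Circle] in
/-- `0 < 2β_c(2)`. [cite: AizenmanSimon1980RotorIsing, eq. (2)] -/
theorem two_mul_criticalBeta_two_pos : 0 < 2 * criticalBeta 2 :=
  mul_pos two_pos (criticalBeta_pos_holds (d := 2) le_rfl)

/-- **No stiffness in Aizenman–Simon's window, stated with `β_c(2)`.** For every `0 ≤ K < 2β_c(2)` the helicity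
modulus of the plane rotator on `(ℤ/Lℤ)²` tends to zero, `βΥ_{L+1}(K) → 0` — §2 at `d = 2` fed into the box-criterion
engine `tendsto_torusXYStiffness_of_nnBoxShellSum_lt_one`. Contains `tendsto_torusXYStiffness_of_lt_log_one_add_sqrt_two`.
[cite: AizenmanSimon1980RotorIsing, eq. (2); FisherBarberJasnow1973, §II (helicity modulus)] -/
theorem tendsto_torusXYStiffness_of_lt_two_mul_criticalBeta_two {K : ℝ} (hK0 : 0 ≤ K)
    (hK : K < 2 * criticalBeta 2) :
    Tendsto (fun L : ℕ => torusXYStiffness (L + 1) K) atTop (𝓝 0) := by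
  obtain ⟨R, hR, hS⟩ := exists_nnBoxShellSum_lt_one_of_lt_two_mul_criticalBeta (d := 2) le_rfl hK0 hK
  exact tendsto_torusXYStiffness_of_nnBoxShellSum_lt_one hR hK0 hS

/-- Re-indexing of the helicity modulus along equal sizes (the size instance is a proposition). [folklore] -/
private theorem torusXYStiffness_congr_size' {L L' : ℕ} [NeZero L] [NeZero L'] (h : L = L') (K : ℝ) :
    torusXYStiffness L K = torusXYStiffness L' K := by
  subst h; rfl

/-- **The same along any divergent sequence of sizes** `L_n → ∞`: `βΥ_{L_n}(K) → 0` for `0 ≤ K < 2β_c(2)`.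
[cite: AizenmanSimon1980RotorIsing, eq. (2); FisherBarberJasnow1973, §II (helicity modulus)] -/
theorem tendsto_torusXYStiffness_comp_of_lt_two_mul_criticalBeta_two {K : ℝ} (hK0 : 0 ≤ K)
    (hK : K < 2 * criticalBeta 2) (Ls : ℕ → ℕ) [∀ n, NeZero (Ls n)] (hLs : Tendsto Ls atTop atTop) :
    Tendsto (fun n => torusXYStiffness (Ls n) K) atTop (𝓝 0) := by
  have h := (tendsto_torusXYStiffness_of_lt_two_mul_criticalBeta_two hK0 hK).comp
    ((tendsto_sub_atTop_nat 1).comp hLs)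
  refine h.congr fun n => ?_
  simp only [Function.comp_def]
  exact torusXYStiffness_congr_size' (Nat.sub_add_cancel (Nat.one_le_iff_ne_zero.2 (NeZero.ne (Ls n)))) K

omit [MeasurableSpace Circle] [BorelSpace Circle] in
/-- `J/(2β_c(2)) < T` with `J > 0` puts `K = J/T` in the window `0 ≤ K < 2β_c(2)` (and `T > 0`). [folklore] -/
private theorem coupling_mem_window' {J T : ℝ} (hJ : 0 < J) (hT : J / (2 * criticalBeta 2) < T) :
    0 < T ∧ 0 ≤ J / T ∧ J / T < 2 * criticalBeta 2 := by
  have h2 := two_mul_criticalBeta_two_pos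
  have hT0 : 0 < T := (div_pos hJ h2).trans hT
  refine ⟨hT0, by positivity, ?_⟩
  rw [div_lt_iff₀ hT0]
  rw [div_lt_iff₀ h2] at hT
  linarith

/-- **The thermodynamic stiffness vanishes for `T > J/(2β_c(2)) = ½T_c^{Ising}(ℤ²)`.** Let `J > 0` and
`T > J/(2β_c(2))`; if along some divergent sequence of sizes `L_n → ∞` the finite-volume stiffness
`T·βΥ_{L_n}(J/T)` converges to `ρ`, then `ρ = 0`.
[cite: AizenmanSimon1980RotorIsing, eq. (2); FisherBarberJasnow1973, eq. (2.5) (thermodynamic helicity modulus)] -/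
theorem eq_zero_of_tendsto_torusXYStiffness_of_div_two_mul_criticalBeta_two_lt {J T ρ : ℝ} (hJ : 0 < J)
    (hT : J / (2 * criticalBeta 2) < T) (Ls : ℕ → ℕ) [∀ n, NeZero (Ls n)] (hLs : Tendsto Ls atTop atTop)
    (hlim : Tendsto (fun n => T * torusXYStiffness (Ls n) (J / T)) atTop (𝓝 ρ)) : ρ = 0 := by
  obtain ⟨-, hK0, hK⟩ := coupling_mem_window' hJ hT
  have h0 := (tendsto_torusXYStiffness_comp_of_lt_two_mul_criticalBeta_two hK0 hK Ls hLs).const_mul T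
  rw [mul_zero] at h0
  exact tendsto_nhds_unique hlim h0

/-- **`T_c^{XY} ≤ ½·T_c^{Ising}(ℤ²)` for every stiffness profile positive below `T_c` — Aizenman–Simon's sentence
«`k T_c^R/J ≤ 1/(2β_c^I)`» for the square lattice, with the TRUE Ising critical point and no universal-jump input.**
Let `J > 0` and let `ρ(T) = lim_n T·βΥ_{L_n}(J/T)` along sizes `L_n → ∞` for `0 < T < T_c`; if `ρ > 0` on `(0, T_c)`
then `T_c ≤ J/(2β_c(2))`. Since `2β_c(2) ≥ log(1+√2)` this implies the Onsager-window bound of record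
(tree `kt_le_div_log_one_add_sqrt_two_of_pos_below`, via `div_two_mul_criticalBeta_two_le_div_log`).
[cite: AizenmanSimon1980RotorIsing, eq. (2) (β_c^R ≥ 2β_c^I)] -/
theorem kt_le_div_two_mul_criticalBeta_two_of_pos_below {ρ : ℝ → ℝ} {Tc J : ℝ} (hJ : 0 < J)
    (hpos : ∀ ⦃T : ℝ⦄, 0 < T → T < Tc → 0 < ρ T)
    (Ls : ℕ → ℕ) [∀ n, NeZero (Ls n)] (hLs : Tendsto Ls atTop atTop)
    (hlim : ∀ ⦃T : ℝ⦄, 0 < T → T < Tc →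
      Tendsto (fun n => T * torusXYStiffness (Ls n) (J / T)) atTop (𝓝 (ρ T))) :
    Tc ≤ J / (2 * criticalBeta 2) := by
  by_contra h
  have hlt : J / (2 * criticalBeta 2) < Tc := lt_of_not_ge h
  set T : ℝ := (J / (2 * criticalBeta 2) + Tc) / 2 with hTdef
  have hT1 : J / (2 * criticalBeta 2) < T := by rw [hTdef]; linarith
  have hT2 : T < Tc := by rw [hTdef]; linarith
  obtain ⟨hT0, -, -⟩ := coupling_mem_window' hJ hT1
  have hzero := eq_zero_of_tendsto_torusXYStiffness_of_div_two_mul_criticalBeta_two_lt hJ hT1 Ls hLs (hlim hT0 hT2)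
  exact (hpos hT0 hT2).ne' hzero

omit [MeasurableSpace Circle] [BorelSpace Circle] in
/-- `J/(2β_c(2)) ≤ J/log(1+√2)` for `J ≥ 0`: the `β_c(2)`-form of the bound is at least as sharp as the Onsager-window
form. [cite: AizenmanSimon1980RotorIsing, eq. (2)] -/
theorem div_two_mul_criticalBeta_two_le_div_log {J : ℝ} (hJ : 0 ≤ J) :
    J / (2 * criticalBeta 2) ≤ J / Real.log (1 + Real.sqrt 2) := by
  have hlog : 0 < Real.log (1 + Real.sqrt 2) := by
    rw [log_one_add_sqrt_two_eq_two_mul_criticalBetaTwo]; exact mul_pos two_pos criticalBetaTwo_pos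
  exact div_le_div_of_nonneg_left hJ hlog log_one_add_sqrt_two_le_two_mul_criticalBeta_two

/-- **Instances.** A stiffness transition in the sense of the T1 file (`IsTransitionAt ρ T_c`) of the classical XY
comparison model has `T_c ≤ J/(2β_c(2))`; under the stability inequality `StableBelow ρ T_c` (only its positivity half
is used) the same. [cite: AizenmanSimon1980RotorIsing, eq. (2)] -/
theorem kt_le_div_two_mul_criticalBeta_two_of_isTransitionAt {ρ : ℝ → ℝ} {Tc J : ℝ} (hJ : 0 < J)
    (htr : IsTransitionAt ρ Tc)
    (Ls : ℕ → ℕ) [∀ n, NeZero (Ls n)] (hLs : Tendsto Ls atTop atTop)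
    (hlim : ∀ ⦃T : ℝ⦄, 0 < T → T < Tc →
      Tendsto (fun n => T * torusXYStiffness (Ls n) (J / T)) atTop (𝓝 (ρ T))) :
    Tc ≤ J / (2 * criticalBeta 2) :=
  kt_le_div_two_mul_criticalBeta_two_of_pos_below hJ htr.1 Ls hLs hlim

/-- Under `StableBelow ρ T_c` (positivity half only): `T_c ≤ J/(2β_c(2))`.
[cite: AizenmanSimon1980RotorIsing, eq. (2); Nelson2002Defects, §2.2.2 eq. (2.47) (stability inequality, as hypothesis)] -/
theorem kt_le_div_two_mul_criticalBeta_two_of_stableBelow {ρ : ℝ → ℝ} {Tc J : ℝ} (hJ : 0 < J)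
    (hst : StableBelow ρ Tc)
    (Ls : ℕ → ℕ) [∀ n, NeZero (Ls n)] (hLs : Tendsto Ls atTop atTop)
    (hlim : ∀ ⦃T : ℝ⦄, 0 < T → T < Tc →
      Tendsto (fun n => T * torusXYStiffness (Ls n) (J / T)) atTop (𝓝 (ρ T))) :
    Tc ≤ J / (2 * criticalBeta 2) :=
  kt_le_div_two_mul_criticalBeta_two_of_pos_below hJ (fun _ hT hTTc => hst.pos hT hTTc) Ls hLs hlim

/- The Onsager-window bound of record `T_c ≤ J/log(1+√2)` (`kt_le_div_log_one_add_sqrt_two_of_pos_below`,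
`PlaneRotatorOnsagerWindowStiffness.lean`) follows from `kt_le_div_two_mul_criticalBeta_two_of_pos_below` and
`div_two_mul_criticalBeta_two_le_div_log`; it is already in the tree and is not restated here. -/

/-! ## §5 `d = 3`: the isotropic endpoint of the interlayer grammar -/

namespace PlaneRotator

omit [MeasurableSpace Circle] [BorelSpace Circle] in
/-- **The layered XY couplings at `J⊥ = J∥ = J` are the isotropic nearest-neighbour couplings at `K = βJ`**:
`layeredXYCoupling β J J Λ = nnXYCoupling (βJ) 3 Λ` (`layeredCoupling J J x y = J·𝟙{‖x−y‖₁ = 1}`).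
[cite: LiuStanley1972, p. 272 (layers (J, J, εJ), ε = 1)] -/
theorem layeredXYCoupling_self (β J : ℝ) (Λ : Finset (Site 3)) :
    layeredXYCoupling β J J Λ = nnXYCoupling (β * J) 3 Λ := by
  funext p
  unfold layeredXYCoupling nnXYCoupling layeredCoupling nnCoupling
  split_ifs <;> ring

/-- **The isotropic three-dimensional classical XY model clusters for `βJ < 2β_c(3)`**, i.e.
`T_c^{3D-XY}(J∥ = J⊥ = J) ≤ ½·T_c^{Ising}(ℤ³)` in the only sense available in finite volume: for `0 ≤ β`, `0 ≤ J`,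
`βJ < 2β_c(3)` there is `c > 0` (depending on `βJ` only) with
`⟨cos(θ_a − θ_c)⟩_{Λ; β, J, J} ≤ e^{−c‖a − c‖_∞}` on every finite `Λ ⊂ ℤ³` — the `J⊥ = J∥` endpoint of the layered
model of `LayeredPlaneRotatorDecoupling.lean` / `LayeredPlaneRotatorOnsagerWindow.lean` (whose window is
`βJ∥ < log(1+√2)`, `βJ⊥ ≤ δ` small). `β_c(3)` carries no kernel number.
[cite: AizenmanSimon1980RotorIsing, eq. (2) (any dimension); LiuStanley1972, p. 272] -/
theorem twoPoint_layered_self_exp_decay_of_lt_two_mul_criticalBeta_three {β J : ℝ} (hβ : 0 ≤ β) (hJ : 0 ≤ J)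
    (hK : β * J < 2 * criticalBeta 3) :
    ∃ c : ℝ, 0 < c ∧ ∀ (Λ : Finset (Site 3)) (a b : Λ),
      twoPoint (layeredXYCoupling β J J Λ) a b ≤ Real.exp (-c * ‖(b : Site 3) - a‖) := by
  obtain ⟨c, hc, h⟩ := twoPoint_nn_exp_decay_of_lt_two_mul_criticalBeta (d := 3) (by norm_num)
    (mul_nonneg hβ hJ) hK
  exact ⟨c, hc, fun Λ a b => by rw [layeredXYCoupling_self]; exact h Λ a b⟩

/-- **Temperature form of the isotropic endpoint**: for `J > 0` and `T > J/(2β_c(3))` (`= ½T_c^{Ising}(ℤ³)` in units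
`k_B = 1`) the isotropic layered XY model at inverse temperature `β = 1/T` clusters exponentially on every finite
`Λ ⊂ ℤ³`, uniformly in `Λ`. [cite: AizenmanSimon1980RotorIsing, eq. (2) (any dimension)] -/
theorem twoPoint_layered_self_exp_decay_of_temperature {J T : ℝ} (hJ : 0 < J)
    (hT : J / (2 * criticalBeta 3) < T) :
    ∃ c : ℝ, 0 < c ∧ ∀ (Λ : Finset (Site 3)) (a b : Λ),
      twoPoint (layeredXYCoupling T⁻¹ J J Λ) a b ≤ Real.exp (-c * ‖(b : Site 3) - a‖) := by
  have h3 : 0 < 2 * criticalBeta 3 := mul_pos two_pos (criticalBeta_pos_holds (d := 3) (by norm_num))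
  have hT0 : 0 < T := (div_pos hJ h3).trans hT
  refine twoPoint_layered_self_exp_decay_of_lt_two_mul_criticalBeta_three (inv_pos.2 hT0).le hJ.le ?_
  rw [div_lt_iff₀ h3] at hT
  rw [inv_mul_eq_div, div_lt_iff₀ hT0]
  linarith

end PlaneRotator

end Literature.Probability.LatticeModels

end
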